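import Summits.AtomisticToContinuum.Crystallization.Theorems.FrustratedLawDichotomySchurDomination
import Literature.MathematicalPhysics.StatisticalMechanics.Crystallization

/-!
# FrustratedLawDichotomy · from SCHUR DOMINATION to a two-body PAIR FLOOR in `SchurFloor` shape

`…SchurDomination.schurDomination` (this hand, p827502) is the repaired abstract principle behind lens-5 g34's Schur tail floor.  This file
RADIALISES it into exactly the shape of lens-5's `SchurFloor w ω A` (`−(A·N + 2A·Σ_{i<j} ω(r_ij)) ≤ Σ_{i<j} ψ(r_ij)`, with
`interactionEnergy V y = Σ_i Σ_{j>i} V(dist (y i) (y j))` from the Literature): given a radial PROFILE identity `∫ β(x)β(x − v) dx = c₀·ω(‖v‖)`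
with `ω(0) = 1` and the domination `−ψ(‖z‖) ≤ ∫ K(u)·(β⋆β)(z − u) du`, every finite configuration satisfies
`−(A·N + 2A·interactionEnergy ω y) ≤ interactionEnergy ψ y` with `A = ½‖K‖₁c₀` — so `SchurFloor w ω (½‖K‖₁c₀)` for `ψ = tailPot w`
(`= fun r => lennardJones r * w r`) is `pairFloor_of_domination` VERBATIM.  What remains for `SF₅` is thus exactly lens-5's analytic data:
the profile identity for `β = (1 − |x|²)₊²` (`ω = omega₂`, `c₀ = k₂(0)`) and the 1-D domination certificate `(k₂∗K)(r) ≥ |V·w₅|(r)`.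

DEF-FREE; 0 sorry.  Prover hand 1, gen 12 (decomp-a2c), --supports stmt-AtomisticToContinuum-27623.  [folklore]
-/

noncomputable section

namespace Summit.AtomisticToContinuum.Crystallization.Theorems.FrustratedLawDichotomySchurDomination

open MeasureTheory
open scoped BigOperators
open Literature.MathematicalPhysics.StatisticalMechanics (interactionEnergy)

/-- ★ **Pair floor from Schur domination, in `SchurFloor` shape.**  For `β ≥ 0` continuous with compact support whose autocorrelation has
the radial profile `∫ β(x)β(x − v) dx = c₀·ω(‖v‖)`, `ω(0) = 1`, a nonnegative integrable even `K`, and a radial `ψ` dominated as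
`−ψ(‖z‖) ≤ ∫ K(u)·∫ β(x)β(x − (z − u))`, every finite configuration `y` satisfies
`−(A·N + 2A·interactionEnergy ω y) ≤ interactionEnergy ψ y` with `A = ½(∫K)·c₀`. [folklore: Schur test] -/
theorem pairFloor_of_domination (β K : EuclideanSpace ℝ (Fin 3) → ℝ) (ψ ω : ℝ → ℝ) (c₀ : ℝ)
    (hβc : Continuous β) (hβs : HasCompactSupport β) (hβ0 : ∀ x, 0 ≤ β x)
    (hK0 : ∀ u, 0 ≤ K u) (hKi : Integrable K) (hKev : ∀ u, K (-u) = K u)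
    (hprof : ∀ v, ∫ x, β x * β (x - v) = c₀ * ω ‖v‖) (hω0 : ω 0 = 1)
    (hdom : ∀ z, -ψ ‖z‖ ≤ ∫ u, K u * ∫ x, β x * β (x - (z - u)))
    {N : ℕ} (y : Fin N → EuclideanSpace ℝ (Fin 3)) :
    -((∫ u, K u) * c₀ / 2 * N + 2 * ((∫ u, K u) * c₀ / 2) * interactionEnergy ω y) ≤ interactionEnergy ψ y := by
  have h := schurDomination β K (fun z => ψ ‖z‖) hβc hβs hβ0 hK0 hKi hKev hdom N y
  have hsq : ∫ x, β x ^ 2 = c₀ := by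
    have := hprof 0
    simp only [sub_zero, norm_zero, hω0, mul_one] at this
    rw [← this]
    exact integral_congr_ae (Filter.Eventually.of_forall fun x => by simp [sq])
  have hpair : ∀ i j : Fin N, ∫ x, β x * β (x - (y i - y j)) = c₀ * ω (dist (y i) (y j)) := fun i j => by
    rw [hprof, dist_eq_norm]
  unfold interactionEnergy
  simp only [hsq, hpair, ← Finset.mul_sum, dist_eq_norm] at h ⊢
  have e : (∫ u, K u) / 2 * ((N : ℝ) * c₀ + 2 * (c₀ * ∑ i, ∑ j ∈ Finset.Ioi i, ω ‖y i - y j‖)) =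
      (∫ u, K u) * c₀ / 2 * N + 2 * ((∫ u, K u) * c₀ / 2) * ∑ i, ∑ j ∈ Finset.Ioi i, ω ‖y i - y j‖ := by ring
  linarith

/-- **Pair floor from Schur domination with a MAJORANT profile** (lens-5 g34: «any `ω′ ≥ ω` pointwise with the same `A` gives a valid,
weaker floor»): it suffices that `∫ β² ≤ c₀` and `∫ β(x)β(x − v) dx ≤ c₀·ω(‖v‖)` pointwise — no exact autocorrelation profile is needed.
[folklore] -/
theorem pairFloor_of_domination_le (β K : EuclideanSpace ℝ (Fin 3) → ℝ) (ψ ω : ℝ → ℝ) (c₀ : ℝ)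
    (hβc : Continuous β) (hβs : HasCompactSupport β) (hβ0 : ∀ x, 0 ≤ β x)
    (hK0 : ∀ u, 0 ≤ K u) (hKi : Integrable K) (hKev : ∀ u, K (-u) = K u)
    (hsq : ∫ x, β x ^ 2 ≤ c₀) (hprof : ∀ v, ∫ x, β x * β (x - v) ≤ c₀ * ω ‖v‖)
    (hdom : ∀ z, -ψ ‖z‖ ≤ ∫ u, K u * ∫ x, β x * β (x - (z - u)))
    {N : ℕ} (y : Fin N → EuclideanSpace ℝ (Fin 3)) :
    -((∫ u, K u) * c₀ / 2 * N + 2 * ((∫ u, K u) * c₀ / 2) * interactionEnergy ω y) ≤ interactionEnergy ψ y := by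
  have h := schurDomination β K (fun z => ψ ‖z‖) hβc hβs hβ0 hK0 hKi hKev hdom N y
  have hK1 : 0 ≤ ∫ u, K u := integral_nonneg hK0
  have hpair : ∑ i, ∑ j ∈ Finset.Ioi i, ∫ x, β x * β (x - (y i - y j)) ≤ c₀ * ∑ i, ∑ j ∈ Finset.Ioi i, ω (dist (y i) (y j)) := by
    rw [Finset.mul_sum]
    refine Finset.sum_le_sum fun i _ => ?_
    rw [Finset.mul_sum]
    refine Finset.sum_le_sum fun j _ => ?_
    rw [dist_eq_norm]
    exact hprof _
  unfold interactionEnergy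
  have hN : (N : ℝ) * ∫ x, β x ^ 2 ≤ (N : ℝ) * c₀ := mul_le_mul_of_nonneg_left hsq (Nat.cast_nonneg N)
  have hmono : (∫ u, K u) / 2 * ((N : ℝ) * (∫ x, β x ^ 2) + 2 * ∑ i, ∑ j ∈ Finset.Ioi i, ∫ x, β x * β (x - (y i - y j))) ≤
      (∫ u, K u) / 2 * ((N : ℝ) * c₀ + 2 * (c₀ * ∑ i, ∑ j ∈ Finset.Ioi i, ω (dist (y i) (y j)))) :=
    mul_le_mul_of_nonneg_left (by linarith) (by positivity)
  have e : (∫ u, K u) / 2 * ((N : ℝ) * c₀ + 2 * (c₀ * ∑ i, ∑ j ∈ Finset.Ioi i, ω (dist (y i) (y j)))) =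
      (∫ u, K u) * c₀ / 2 * N + 2 * ((∫ u, K u) * c₀ / 2) * ∑ i, ∑ j ∈ Finset.Ioi i, ω (dist (y i) (y j)) := by ring
  have hφ : ∑ i, ∑ j ∈ Finset.Ioi i, (fun z => ψ ‖z‖) (y i - y j) = ∑ i, ∑ j ∈ Finset.Ioi i, ψ (dist (y i) (y j)) := by
    simp only [dist_eq_norm]
  linarith

end Summit.AtomisticToContinuum.Crystallization.Theorems.FrustratedLawDichotomySchurDomination
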